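import Mathlib
import HarnessLib

/-!
# The transport diagonalises: the Mellin transform of a transported dilate, for an arbitrary continuous seed

Helper file (`--supports stmt-RiemannHypothesis-0098`), pure proofs (one change of variables).  Seat rh-explicit-weil-5 gen14;
generalises `Theorems/WeilTransportDilateMellin.lean` (gen11, monomial seeds) to every seed continuous on the range of the dilate —
in particular to the de-transported profile `S̃` of a certified minimiser (`Theorems/WeilDeTransportMoebius.lean`).

Context (documentation only).  Connes' transport of a seed `S` on `(0, 1]` is `𝓔S(x) = e^{x/2} Σ_{m ≤ M} S(m e^{x−a})` on the window
`[-a, a]`; the dilate `m` lives on `[-a, a − log m]`.  With the Mellin kernel `e^{(s−½)x}` of the window and the substitution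
`w = m e^{x−a}` (`dx = dw/w`):

* `transportDilate_integrand_eq`      : pointwise, `e^{x/2} S(m e^{x−a}) e^{(s−½)x} = (m e^{x−a}) · [e^{sa} e^{−s log m} S(w) e^{(s−1) log w}]`
                                        at `w = m e^{x−a}` — the integrand is `f'(x) · g(f(x))` for `f(x) = m e^{x−a}`;
* `integral_transportDilate_eq_mellin` : `∫_{x₀}^{x₁} e^{x/2} S(m e^{x−a}) e^{(s−½)x} dx = e^{sa} e^{−s log m} ∫_{m e^{x₀−a}}^{m e^{x₁−a}} S(w) e^{(s−1) log w} dw`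
                                        for `S` continuous on `[m e^{x₀−a}, m e^{x₁−a}]` (`m > 0`): THE DILATE `m` CONTRIBUTES `m^{−s}`
                                        TIMES A MELLIN INTEGRAL OF THE SEED — the transport is diagonal in the Mellin variable;
* `integral_transportDilate_window`    : on the dilate's own support `[-a, a − log m]` the range is `[m e^{−2a}, 1]`;
* `transport_mellin_sum`               : summed over `m ≤ M`: `Σ_m ∫_{-a}^{a − log m} … = e^{sa} Σ_{m ≤ M} e^{−s log m} ∫_{m e^{−2a}}^{1} S(w) e^{(s−1) log w} dw`,
                                        i.e. `f̂(s) = e^{sa} D_M(s) M_S(s) −` (the part of each Mellin integral below `m/μ`), the closed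
                                        form of WEIL5-ZSIDE §1 for a general seed;
* `transport_mellin_sum_at_one`        : at ζ's pole `s = 1` the kernel is `1`: `Σ_m (e^{a}/m) ∫_{m/μ}^{1} S`;
* `transport_mellin_sum_at_one_of_mass_zero` : under the POLE-KILLING constraint `∫_0^1 S = 0` (the cell's seeds `ψ₄ − (∫ψ₄/∫ψ₀)ψ₀`,
                                        `ψ₆ − (∫ψ₆/∫ψ₂)ψ₂`) only the far-wall masses survive: `= −e^{a} Σ_m (1/m) ∫_0^{m/μ} S` (gen14 appendix).

Standard axioms only; no `sorry`.
-/

set_option linter.dupNamespace false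
set_option autoImplicit false

noncomputable section

open Real intervalIntegral Set Finset

namespace Summit.RiemannHypothesis.RiemannHypothesis.Theorems.WeilTransportMellinDiagonal

/-- Pointwise form of the substitution `w = m e^{x−a}`: the window's Mellin integrand of the dilate `m` equals
`f'(x) · g(f(x))` with `f(x) = m e^{x−a}` and `g(w) = e^{sa} e^{−s log m} S(w) e^{(s−1) log w}`. -/
theorem transportDilate_integrand_eq (S : ℝ → ℝ) (a m : ℝ) (hm : 0 < m) (s : ℂ) (x : ℝ) :
    (Real.exp (x / 2) : ℂ) * (S (m * Real.exp (x - a)) : ℂ) * Complex.exp ((s - 1 / 2) * x)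
      = ((m * Real.exp (x - a) : ℝ) : ℂ) * (Complex.exp (s * a) * Complex.exp (-(s * Real.log m))
          * (S (m * Real.exp (x - a)) : ℂ) * Complex.exp ((s - 1) * Real.log (m * Real.exp (x - a)))) := by
  have hlog : Real.log (m * Real.exp (x - a)) = Real.log m + (x - a) := by
    rw [Real.log_mul hm.ne' (Real.exp_pos _).ne', Real.log_exp]
  have hme : (m : ℂ) = Complex.exp (Real.log m) := by
    rw [← Complex.ofReal_exp, Real.exp_log hm]
  rw [hlog]
  push_cast
  rw [hme]
  have E : Complex.exp (↑x / 2) * Complex.exp ((s - 1 / 2) * ↑x)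
      = Complex.exp ↑(Real.log m) * Complex.exp (↑x - ↑a) * (Complex.exp (s * ↑a)
          * Complex.exp (-(s * ↑(Real.log m))) * Complex.exp ((s - 1) * (↑(Real.log m) + (↑x - ↑a)))) := by
    simp only [← Complex.exp_add]
    congr 1
    ring
  linear_combination (↑(S (m * Real.exp (x - a))) : ℂ) * E

/-- THE TRANSPORT IS DIAGONAL IN THE MELLIN VARIABLE.  For `m > 0`, any `x₀, x₁` and a seed `S` continuous on
the range `[m e^{x₀−a}, m e^{x₁−a}]` of the dilate:
`∫_{x₀}^{x₁} e^{x/2} S(m e^{x−a}) e^{(s−½)x} dx = e^{sa} e^{−s log m} ∫_{m e^{x₀−a}}^{m e^{x₁−a}} S(w) e^{(s−1) log w} dw`. -/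
theorem integral_transportDilate_eq_mellin (S : ℝ → ℝ) (a m : ℝ) (hm : 0 < m) (s : ℂ) (x₀ x₁ : ℝ)
    (hS : ContinuousOn S (uIcc (m * Real.exp (x₀ - a)) (m * Real.exp (x₁ - a)))) :
    ∫ x in x₀..x₁, (Real.exp (x / 2) : ℂ) * (S (m * Real.exp (x - a)) : ℂ) * Complex.exp ((s - 1 / 2) * x)
      = Complex.exp (s * a) * Complex.exp (-(s * Real.log m))
          * ∫ w in (m * Real.exp (x₀ - a))..(m * Real.exp (x₁ - a)), (S w : ℂ) * Complex.exp ((s - 1) * Real.log w) := by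
  -- the substitution map and its derivative
  set f : ℝ → ℝ := fun x => m * Real.exp (x - a) with hf
  have hfd : ∀ x, HasDerivAt f (m * Real.exp (x - a)) x := by
    intro x
    have h1 : HasDerivAt (fun x : ℝ => x - a) 1 x := (hasDerivAt_id x).sub_const a
    have h2 : HasDerivAt (fun x : ℝ => Real.exp (x - a)) (Real.exp (x - a) * 1) x := (Real.hasDerivAt_exp _).comp x h1
    simpa using h2.const_mul m
  have hmono : Monotone f := by
    intro x y hxy; simp only [hf]
    exact mul_le_mul_of_nonneg_left (Real.exp_le_exp.mpr (by linarith)) hm.le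
  have himg : f '' uIcc x₀ x₁ ⊆ uIcc (f x₀) (f x₁) := hmono.image_uIcc_subset
  have hpos : ∀ w ∈ uIcc (f x₀) (f x₁), 0 < w := by
    intro w hw
    have hlo : min (f x₀) (f x₁) ≤ w := (Set.mem_uIcc.mp hw).elim (fun h => le_trans (min_le_left _ _) h.1)
      (fun h => le_trans (min_le_right _ _) h.1)
    have : 0 < min (f x₀) (f x₁) := lt_min (mul_pos hm (Real.exp_pos _)) (mul_pos hm (Real.exp_pos _))
    linarith
  -- g and its continuity on the image
  set g : ℝ → ℂ := fun w => Complex.exp (s * a) * Complex.exp (-(s * Real.log m)) * (S w : ℂ)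
    * Complex.exp ((s - 1) * Real.log w) with hg
  have hgc : ContinuousOn g (f '' uIcc x₀ x₁) := by
    refine ContinuousOn.mono ?_ himg
    have hSc : ContinuousOn (fun w => (S w : ℂ)) (uIcc (f x₀) (f x₁)) :=
      Complex.continuous_ofReal.comp_continuousOn hS
    have hlogc : ContinuousOn (fun w => Complex.exp ((s - 1) * Real.log w)) (uIcc (f x₀) (f x₁)) := by
      refine (Complex.continuous_exp.comp_continuousOn ?_)
      refine ContinuousOn.mul continuousOn_const ?_
      exact Complex.continuous_ofReal.comp_continuousOn
        (Real.continuousOn_log.mono fun w hw => (hpos w hw).ne')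
    exact (continuousOn_const.mul hSc).mul hlogc
  -- substitute
  have key := intervalIntegral.integral_deriv_smul_comp' (f := f) (f' := fun x => m * Real.exp (x - a)) (g := g)
    (a := x₀) (b := x₁) (fun x _ => hfd x) ((continuous_const.mul (Real.continuous_exp.comp
      (continuous_id.sub continuous_const))).continuousOn) hgc
  -- rewrite the left integrand pointwise
  have lhs : (fun x => (Real.exp (x / 2) : ℂ) * (S (m * Real.exp (x - a)) : ℂ) * Complex.exp ((s - 1 / 2) * x))
      = fun x => (m * Real.exp (x - a)) • (g ∘ f) x := by
    funext x
    rw [transportDilate_integrand_eq S a m hm s x, Complex.real_smul]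
    simp only [hg, hf, Function.comp_apply]
  rw [lhs, key]
  simp only [hg, hf]
  rw [← intervalIntegral.integral_const_mul]
  refine intervalIntegral.integral_congr fun w _ => ?_
  ring

/-- On the dilate's own support `[-a, a − log m]` (`m > 0`) the range of `w = m e^{x−a}` is `[m e^{−2a}, 1]`:
`∫_{-a}^{a − log m} e^{x/2} S(m e^{x−a}) e^{(s−½)x} dx = e^{sa} e^{−s log m} ∫_{m e^{−2a}}^{1} S(w) e^{(s−1) log w} dw`. -/
theorem integral_transportDilate_window (S : ℝ → ℝ) (a m : ℝ) (hm : 0 < m) (s : ℂ)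
    (hS : ContinuousOn S (uIcc (m * Real.exp (-(2 * a))) 1)) :
    ∫ x in (-a)..(a - Real.log m), (Real.exp (x / 2) : ℂ) * (S (m * Real.exp (x - a)) : ℂ) * Complex.exp ((s - 1 / 2) * x)
      = Complex.exp (s * a) * Complex.exp (-(s * Real.log m))
          * ∫ w in (m * Real.exp (-(2 * a)))..1, (S w : ℂ) * Complex.exp ((s - 1) * Real.log w) := by
  have h0 : m * Real.exp (-a - a) = m * Real.exp (-(2 * a)) := by ring_nf
  have h1 : m * Real.exp (a - Real.log m - a) = 1 := by
    rw [show a - Real.log m - a = -Real.log m by ring, Real.exp_neg, Real.exp_log hm]; field_simp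
  have := integral_transportDilate_eq_mellin S a m hm s (-a) (a - Real.log m) (by rwa [h0, h1])
  rwa [h0, h1] at this

/-- THE CLOSED FORM FOR A GENERAL SEED, summed over the dilates `m ≤ M`:
`Σ_{m ≤ M} ∫_{-a}^{a − log m} e^{x/2} S(m e^{x−a}) e^{(s−½)x} dx = e^{sa} Σ_{m ≤ M} e^{−s log m} ∫_{m e^{−2a}}^{1} S(w) e^{(s−1) log w} dw`
(for `S` continuous on `[e^{−2a}, 1]`, which contains every dilate's range when `M ≤ e^{2a}`).  Splitting each `∫_{m e^{−2a}}^{1}`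
as `∫_0^1 − ∫_0^{m e^{−2a}}` exhibits `e^{sa} D_M(s) M_S(s)` (with `D_M(s) = Σ_{m ≤ M} m^{−s}`) minus the far-wall term. -/
theorem transport_mellin_sum (S : ℝ → ℝ) (a : ℝ) (M : ℕ) (hM : (M : ℝ) ≤ Real.exp (2 * a)) (s : ℂ)
    (hS : ContinuousOn S (Icc (Real.exp (-(2 * a))) 1)) :
    ∑ m ∈ Icc 1 M, ∫ x in (-a)..(a - Real.log m),
        (Real.exp (x / 2) : ℂ) * (S (m * Real.exp (x - a)) : ℂ) * Complex.exp ((s - 1 / 2) * x)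
      = Complex.exp (s * a) * ∑ m ∈ Icc 1 M, Complex.exp (-(s * Real.log m))
          * ∫ w in ((m : ℝ) * Real.exp (-(2 * a)))..1, (S w : ℂ) * Complex.exp ((s - 1) * Real.log w) := by
  rw [Finset.mul_sum]
  refine Finset.sum_congr rfl fun m hm => ?_
  have hm1 : 1 ≤ m := (Finset.mem_Icc.mp hm).1
  have hmM : m ≤ M := (Finset.mem_Icc.mp hm).2
  have hm0 : (0 : ℝ) < m := by exact_mod_cast hm1
  have hlo : Real.exp (-(2 * a)) ≤ (m : ℝ) * Real.exp (-(2 * a)) :=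
    le_mul_of_one_le_left (Real.exp_pos _).le (by exact_mod_cast hm1)
  have hhi : (m : ℝ) * Real.exp (-(2 * a)) ≤ 1 := by
    have : (m : ℝ) ≤ Real.exp (2 * a) := le_trans (by exact_mod_cast hmM) hM
    rw [Real.exp_neg]
    exact (mul_inv_le_iff₀ (Real.exp_pos _)).mpr (by simpa using this)
  have hS' : ContinuousOn S (uIcc ((m : ℝ) * Real.exp (-(2 * a))) 1) := by
    rw [uIcc_of_le hhi]
    exact hS.mono (Icc_subset_Icc hlo le_rfl)
  rw [integral_transportDilate_window S a m hm0 s hS', mul_assoc]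


/-- AT THE POLE `s = 1` the Mellin kernel `e^{(s−1) log w}` is `1`: the dilate `m` contributes `e^{a} e^{−log m} ∫_{m e^{−2a}}^{1} S(w) dw`
(`= (e^{a}/m)·∫_{m/μ}^{1} S`).  Summed over `m ≤ M` this is the window transform at ζ's pole: the harmonic sum `Σ_m 1/m` weights the
seed's MASS above the far-wall points `m/μ`. -/
theorem transport_mellin_sum_at_one (S : ℝ → ℝ) (a : ℝ) (M : ℕ) (hM : (M : ℝ) ≤ Real.exp (2 * a))
    (hS : ContinuousOn S (Icc (Real.exp (-(2 * a))) 1)) :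
    ∑ m ∈ Icc 1 M, ∫ x in (-a)..(a - Real.log m),
        (Real.exp (x / 2) : ℂ) * (S (m * Real.exp (x - a)) : ℂ) * Complex.exp (((1 : ℂ) - 1 / 2) * x)
      = Complex.exp a * ∑ m ∈ Icc 1 M, Complex.exp (-(Real.log m : ℂ))
          * ∫ w in ((m : ℝ) * Real.exp (-(2 * a)))..1, (S w : ℂ) := by
  have h := transport_mellin_sum S a M hM 1 hS
  simp only [one_mul, sub_self, zero_mul, Complex.exp_zero, mul_one] at h
  exact h

/-- THE POLE-KILLING CONSTRAINT.  If the seed has zero mass, `∫_0^1 S = 0` (`M_S(1) = 0` — the normalisation of the cell's seeds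
`ψ₄ − (∫ψ₄/∫ψ₀)ψ₀`, `ψ₆ − (∫ψ₆/∫ψ₂)ψ₂`), then each dilate's contribution at `s = 1` is MINUS its far-wall mass:
`∫_{m/μ}^{1} S = −∫_0^{m/μ} S`, so the window transform at the pole reduces to `−e^{a} Σ_{m ≤ M} (1/m) ∫_0^{m e^{−2a}} S(w) dw` —
only the part of the seed below the far-wall points survives (for `S` continuous on `[0, 1]`). -/
theorem transport_mellin_sum_at_one_of_mass_zero (S : ℝ → ℝ) (a : ℝ) (M : ℕ) (hM : (M : ℝ) ≤ Real.exp (2 * a))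
    (hS : ContinuousOn S (Icc 0 1)) (hmass : ∫ w in (0 : ℝ)..1, S w = 0) :
    ∑ m ∈ Icc 1 M, ∫ x in (-a)..(a - Real.log m),
        (Real.exp (x / 2) : ℂ) * (S (m * Real.exp (x - a)) : ℂ) * Complex.exp (((1 : ℂ) - 1 / 2) * x)
      = -(Complex.exp a * ∑ m ∈ Icc 1 M, Complex.exp (-(Real.log m : ℂ))
          * ∫ w in (0 : ℝ)..((m : ℝ) * Real.exp (-(2 * a))), (S w : ℂ)) := by
  have hS' : ContinuousOn S (Icc (Real.exp (-(2 * a))) 1) := hS.mono (Icc_subset_Icc (Real.exp_pos _).le le_rfl)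
  have hint : IntervalIntegrable (fun w => (S w : ℂ)) MeasureTheory.volume 0 1 := by
    refine ContinuousOn.intervalIntegrable ?_
    rw [Set.uIcc_of_le zero_le_one]
    exact Complex.continuous_ofReal.comp_continuousOn hS
  have hmassC : ∫ w in (0 : ℝ)..1, (S w : ℂ) = 0 := by
    rw [intervalIntegral.integral_ofReal, hmass]; simp
  -- termwise: ∫_{m/μ}^1 S = ∫_0^1 S − ∫_0^{m/μ} S = −∫_0^{m/μ} S
  have key : ∀ m ∈ Finset.Icc 1 M,
      Complex.exp (-(Real.log m : ℂ)) * ∫ w in ((m : ℝ) * Real.exp (-(2 * a)))..1, (S w : ℂ)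
        = -(Complex.exp (-(Real.log m : ℂ)) * ∫ w in (0 : ℝ)..((m : ℝ) * Real.exp (-(2 * a))), (S w : ℂ)) := by
    intro m hm
    have hmM : m ≤ M := (Finset.mem_Icc.mp hm).2
    have hlo : 0 ≤ (m : ℝ) * Real.exp (-(2 * a)) := by positivity
    have hhi : (m : ℝ) * Real.exp (-(2 * a)) ≤ 1 := by
      have : (m : ℝ) ≤ Real.exp (2 * a) := le_trans (by exact_mod_cast hmM) hM
      rw [Real.exp_neg]
      exact (mul_inv_le_iff₀ (Real.exp_pos _)).mpr (by simpa using this)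
    have h1 : IntervalIntegrable (fun w => (S w : ℂ)) MeasureTheory.volume 0 ((m : ℝ) * Real.exp (-(2 * a))) :=
      hint.mono_set (by rw [Set.uIcc_of_le zero_le_one, Set.uIcc_of_le hlo]; exact Set.Icc_subset_Icc le_rfl hhi)
    have h2 : IntervalIntegrable (fun w => (S w : ℂ)) MeasureTheory.volume ((m : ℝ) * Real.exp (-(2 * a))) 1 :=
      hint.mono_set (by rw [Set.uIcc_of_le zero_le_one, Set.uIcc_of_le hhi]; exact Set.Icc_subset_Icc hlo le_rfl)
    have hsplit := intervalIntegral.integral_add_adjacent_intervals h1 h2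
    rw [hmassC] at hsplit
    have : ∫ w in ((m : ℝ) * Real.exp (-(2 * a)))..1, (S w : ℂ)
        = -∫ w in (0 : ℝ)..((m : ℝ) * Real.exp (-(2 * a))), (S w : ℂ) := by
      linear_combination hsplit
    rw [this, mul_neg]
  rw [transport_mellin_sum_at_one S a M hM hS', Finset.sum_congr rfl key, Finset.sum_neg_distrib, mul_neg]

end Summit.RiemannHypothesis.RiemannHypothesis.Theorems.WeilTransportMellinDiagonal

end
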